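import Summits.QuantumFields.YangMills.Theorems.AllWindowsColdBoxBoxHighLineQuarticVertexRankOne
import Summits.QuantumFields.YangMills.Theorems.AllWindowsColdBoxBoxHighLineWickPairCubicColdBox

/-!
# `ConnectedThreePoint`, QUARTIC vertices, COLD BOX: the two centred `linCurvSq`-type forms of the plaquettes `p₀`, `p_T` against a local quartic monomial at `x`
# have connected size `≤ β⁻⁴·C·(1+log H)⁴·[(1+d(x,p₀))⁻⁶(1+d(x,p_T))⁻⁶ + (1+‖p₀−p_T‖₁)⁻⁴(1+d(x,p₀))⁻³(1+d(x,p_T))⁻³]` (U5-BLOCKERS §2 L2, blocker B2, quartic part)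

Width seat `ym-line-sfw-p2-w3` (g41), cell ym-idea-1; U5 prep, helper-grade.  Cold-box instance of ✓`gauss_centredRankOne_centredRankOne_mul_four_connected`
(`…QuarticVertexRankOne`): `g = (hodgeQ H)⁻¹`, `S = (2β)⁻¹(g⊗1)`, `w₀ = landauCoeff H p₀`, `w₁ = landauCoeff H p_T`, the four vertex legs `n_s` within sup-distance `1` of a
site `x` (the quartic monomials of `W₄` / `Φ⁴` / Haar⁴ are local), and the line's kernel decays: gradient lines ✓`RestBlock.landauKernelGradDecay` (as in
✓`WickPairCubic.abs_gaussAvg_centredLandauForm_mul_three_mul_three_le`), the dipole `(w₀ ᵥ* g)⬝w₁ = K(p_T,p₀)` ✓`RestBlock.landauDipoleDecay`, and the self-line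
`|S(n,n')| ≤ (2β)⁻¹·C(1+log H)` ✓`EdgeChartGaussian.coldBox_propagator_decay`:

* `gaussAvg_centredRankOne_centredRankOne_mul_four_connected` — the `gaussAvg β H` transcription of the collapsed formula («X» + «tadpoles»);
* ★★ `abs_gaussAvg_centredLandauForms_mul_four_connected_le` — the size bound above.
RELATIVE to the main term `≍ T⁻⁸` (after the expansion coefficients and the vertex sum `Σ_x`, crude two-centre sums ✓`EdgeSums.edgeTwoCentreSums`): `H⁴·polylog/β`,
replacing blocker B2's Cauchy–Schwarz `H¹²/β` for the quartic even vertices; together with ✓`…Cum3TriangleGhostHaar` (quadratic vertices) and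
✓`…WickPairCubicColdBox` (odd part) this completes the per-monomial L2 kit of ASSEMBLY-U5 §3 `f′(0)`.

Tree only; no definitions; standard axioms.  HONEST LABEL: a tool for the RECORDED lift L2 of the NEXT rung U5 (⟨stmt-QuantumFields-24336⟩, UNSTAFFED); ⟨24004⟩
⟨24336⟩ remain OPEN; route AllWindowsColdBox is DRAFT; no crux, rung or summit is proved; **the Yang–Mills mass gap is NOT proved by this file; no summit is
proved by a line.**
-/

set_option autoImplicit false

noncomputable section

open MeasureTheory Matrix Finset
open scoped Kronecker
open Literature.Probability.LatticeModels (Site)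
open Literature.MathematicalPhysics.QuantumFieldTheory (Plaq)

namespace Summit.QuantumFields.YangMills.Theorems.AllWindowsColdBoxBoxHighLine

namespace WickPairCubic

open QuadFluct (boxQuadForm_eq_flat)
open LaplaceSandwich (flatten flatten_apply)

variable {H : ℕ}

/-- `|c·[κ=κ']·u_i·v_j| ≤ c·B_u·B_v` from `|u_i| ≤ B_u`, `|v_j| ≤ B_v`, `c ≥ 0`. -/
theorem abs_smul_ite_mul_le {c Bu Bv : ℝ} (hc : 0 ≤ c) (P : Prop) [Decidable P] {a b : ℝ} (ha : |a| ≤ Bu) (hb : |b| ≤ Bv) :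
    |c * (if P then a * b else 0)| ≤ c * (Bu * Bv) := by
  have hBu : 0 ≤ Bu := (abs_nonneg _).trans ha
  rw [abs_mul, abs_of_nonneg hc]
  refine mul_le_mul_of_nonneg_left ?_ hc
  split_ifs
  · rw [abs_mul]; exact mul_le_mul ha hb (abs_nonneg _) hBu
  · rw [abs_zero]; exact mul_nonneg hBu ((abs_nonneg _).trans hb)

/-- `|c·[P]·(k·(u_i·v_j))| ≤ c·(B_k·(B_u·B_v))`. -/
theorem abs_smul_ite_mul_mul_le {c Bk Bu Bv : ℝ} (hc : 0 ≤ c) (P : Prop) [Decidable P] {k a b : ℝ} (hk : |k| ≤ Bk) (ha : |a| ≤ Bu)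
    (hb : |b| ≤ Bv) : |c * (if P then k * (a * b) else 0)| ≤ c * (Bk * (Bu * Bv)) := by
  have hBk : 0 ≤ Bk := (abs_nonneg _).trans hk
  have hBu : 0 ≤ Bu := (abs_nonneg _).trans ha
  rw [abs_mul, abs_of_nonneg hc]
  refine mul_le_mul_of_nonneg_left ?_ hc
  split_ifs
  · rw [abs_mul, abs_mul]; exact mul_le_mul hk (mul_le_mul ha hb (abs_nonneg _) hBu) (by positivity) hBk
  · rw [abs_zero]; exact mul_nonneg hBk (mul_nonneg hBu ((abs_nonneg _).trans hb))

/-- **Cold-box transcription of the collapsed quartic-vertex formula** (`gaussAvg β H` letters). -/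
theorem gaussAvg_centredRankOne_centredRankOne_mul_four_connected {β : ℝ} (hβ : 0 < β) (w₀ w₁ : LandauFree H → ℝ)
    (S LA LB DA DB TD : LandauFree H × Fin 3 → LandauFree H × Fin 3 → ℝ)
    (hS : ∀ i j, S i j = (2 * β)⁻¹ * if i.2 = j.2 then (hodgeQ H)⁻¹ i.1 j.1 else 0)
    (hLA : ∀ i j, LA i j = if i.2 = j.2 then w₀ i.1 * w₀ j.1 else 0) (hLB : ∀ i j, LB i j = if i.2 = j.2 then w₁ i.1 * w₁ j.1 else 0)
    (hDA : ∀ i j, DA i j = (2 * β)⁻¹ ^ 2 * if i.2 = j.2 then (w₀ ᵥ* (hodgeQ H)⁻¹) i.1 * (w₀ ᵥ* (hodgeQ H)⁻¹) j.1 else 0)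
    (hDB : ∀ i j, DB i j = (2 * β)⁻¹ ^ 2 * if i.2 = j.2 then (w₁ ᵥ* (hodgeQ H)⁻¹) i.1 * (w₁ ᵥ* (hodgeQ H)⁻¹) j.1 else 0)
    (hTD : ∀ i j, TD i j = (2 * β)⁻¹ ^ 3 * if i.2 = j.2 then
      ((w₀ ᵥ* (hodgeQ H)⁻¹) ⬝ᵥ w₁) * ((w₀ ᵥ* (hodgeQ H)⁻¹) i.1 * (w₁ ᵥ* (hodgeQ H)⁻¹) j.1) else 0)
    (n₀ n₁ n₂ n₃ : LandauFree H × Fin 3) :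
    gaussAvg β H (fun a => (∑ b, ∑ b', LA b b' * (a b.1 b.2 * a b'.1 b'.2 - S b b')) *
        (∑ b, ∑ b', LB b b' * (a b.1 b.2 * a b'.1 b'.2 - S b b')) * (a n₀.1 n₀.2 * a n₁.1 n₁.2 * a n₂.1 n₂.2 * a n₃.1 n₃.2)) -
      gaussAvg β H (fun a => (∑ b, ∑ b', LA b b' * (a b.1 b.2 * a b'.1 b'.2 - S b b')) *
        (∑ b, ∑ b', LB b b' * (a b.1 b.2 * a b'.1 b'.2 - S b b'))) *
      gaussAvg β H (fun a => a n₀.1 n₀.2 * a n₁.1 n₁.2 * a n₂.1 n₂.2 * a n₃.1 n₃.2) =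
      4 * (DA n₀ n₁ * DB n₂ n₃ + DA n₀ n₂ * DB n₁ n₃ + DA n₀ n₃ * DB n₁ n₂ + DA n₁ n₂ * DB n₀ n₃ + DA n₁ n₃ * DB n₀ n₂ + DA n₂ n₃ * DB n₀ n₁) +
      4 * (TD n₀ n₁ * S n₂ n₃ +
        TD n₀ n₂ * S n₁ n₃ +
        TD n₀ n₃ * S n₁ n₂ +
        TD n₁ n₀ * S n₂ n₃ +
        TD n₁ n₂ * S n₀ n₃ +
        TD n₁ n₃ * S n₀ n₂ +
        TD n₂ n₀ * S n₁ n₃ +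
        TD n₂ n₁ * S n₀ n₃ +
        TD n₂ n₃ * S n₀ n₁ +
        TD n₃ n₀ * S n₁ n₂ +
        TD n₃ n₁ * S n₀ n₂ +
        TD n₃ n₂ * S n₀ n₁) := by
  set Pm : Matrix (LandauFree H × Fin 3) (LandauFree H × Fin 3) ℝ := hodgeQ H ⊗ₖ (1 : Matrix (Fin 3) (Fin 3) ℝ) with hPdef
  have hP : Pm.PosDef := GaussianChartWick.posDef_kronecker_one _ (hodgeQ_posDef H)
  have hSP : ∀ i j, S i j = (2 * β)⁻¹ * Pm⁻¹ i j := fun i j => by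
    rw [hS, hPdef, EdgeChartGaussian.kronecker_one_inv_apply (hodgeQ H) (hodgeQ_posDef H).det_pos.ne']
  have h0 := integral_flat_mul_gaussWeight β H (fun _ => 1)
  simp only [one_mul] at h0
  have hA : ∫ a : LandauFree H → E3, (fun a : LandauFree H → E3 => (∑ b, ∑ b', LA b b' * (a b.1 b.2 * a b'.1 b'.2 - S b b')) *
        (∑ b, ∑ b', LB b b' * (a b.1 b.2 * a b'.1 b'.2 - S b b')) * (a n₀.1 n₀.2 * a n₁.1 n₁.2 * a n₂.1 n₂.2 * a n₃.1 n₃.2)) a *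
        gaussWeight β H a =
      ∫ v : LandauFree H × Fin 3 → ℝ, (∑ b, ∑ b', LA b b' * (v b * v b' - S b b')) * (∑ b, ∑ b', LB b b' * (v b * v b' - S b b')) *
        (v n₀ * v n₁ * v n₂ * v n₃) * Real.exp (-(β * (v ⬝ᵥ (Pm *ᵥ v)))) := by
    refine Eq.trans (integral_congr_ae (Filter.Eventually.of_forall fun a => ?_))
      (integral_flat_mul_gaussWeight β H (fun v => (∑ b, ∑ b', LA b b' * (v b * v b' - S b b')) *
        (∑ b, ∑ b', LB b b' * (v b * v b' - S b b')) * (v n₀ * v n₁ * v n₂ * v n₃)))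
    simp only [flatten_apply_pair]
  have hB : ∫ a : LandauFree H → E3, (fun a : LandauFree H → E3 => (∑ b, ∑ b', LA b b' * (a b.1 b.2 * a b'.1 b'.2 - S b b')) *
        (∑ b, ∑ b', LB b b' * (a b.1 b.2 * a b'.1 b'.2 - S b b'))) a * gaussWeight β H a =
      ∫ v : LandauFree H × Fin 3 → ℝ, (∑ b, ∑ b', LA b b' * (v b * v b' - S b b')) * (∑ b, ∑ b', LB b b' * (v b * v b' - S b b')) *
        Real.exp (-(β * (v ⬝ᵥ (Pm *ᵥ v)))) := by
    refine Eq.trans (integral_congr_ae (Filter.Eventually.of_forall fun a => ?_))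
      (integral_flat_mul_gaussWeight β H (fun v => (∑ b, ∑ b', LA b b' * (v b * v b' - S b b')) *
        (∑ b, ∑ b', LB b b' * (v b * v b' - S b b'))))
    simp only [flatten_apply_pair]
  have hN : ∫ a : LandauFree H → E3, (fun a : LandauFree H → E3 => a n₀.1 n₀.2 * a n₁.1 n₁.2 * a n₂.1 n₂.2 * a n₃.1 n₃.2) a *
        gaussWeight β H a =
      ∫ v : LandauFree H × Fin 3 → ℝ, v n₀ * v n₁ * v n₂ * v n₃ * Real.exp (-(β * (v ⬝ᵥ (Pm *ᵥ v)))) := by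
    refine Eq.trans (integral_congr_ae (Filter.Eventually.of_forall fun a => ?_))
      (integral_flat_mul_gaussWeight β H (fun v => v n₀ * v n₁ * v n₂ * v n₃))
    simp only [flatten_apply_pair]
  unfold gaussAvg
  rw [hA, hB, hN, h0]
  exact gauss_centredRankOne_centredRankOne_mul_four_connected Pm hP hβ ((hodgeQ H)⁻¹) w₀ w₁ S LA LB DA DB TD hSP hS hLA hLB hDA hDB hTD
    n₀ n₁ n₂ n₃

/-- ★★ **Size of the connected quartic-vertex block, cold box.**  For `H ≥ 1`, `β > 0`, plaquettes `p q` (the centred `linCurvSq`-type forms of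
`landauCoeff H p`, `landauCoeff H q`) and a quartic monomial whose four legs lie within sup-distance `1` of a site `x`:
`|E₀[Q_pQ_qN] − E₀[Q_pQ_q]E₀[N]| ≤ β⁻¹^4·C·(1+log H)^4·(1/((1+d(x,p.1))^6(1+d(x,q.1))^6) + 1/((1+‖p−q‖₁)^4(1+d(x,p.1))^3(1+d(x,q.1))^3))`. -/
theorem abs_gaussAvg_centredLandauForms_mul_four_connected_le : ∃ C : ℝ, 0 ≤ C ∧ ∀ H : ℕ, 1 ≤ H → ∀ β : ℝ, 0 < β →
    ∀ (p q : Plaq 4) (S LA LB : LandauFree H × Fin 3 → LandauFree H × Fin 3 → ℝ),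
    (∀ i j, S i j = (2 * β)⁻¹ * if i.2 = j.2 then (hodgeQ H)⁻¹ i.1 j.1 else 0) →
    (∀ i j, LA i j = if i.2 = j.2 then landauCoeff H p i.1 * landauCoeff H p j.1 else 0) →
    (∀ i j, LB i j = if i.2 = j.2 then landauCoeff H q i.1 * landauCoeff H q j.1 else 0) →
    ∀ (x : Site 4) (n₀ n₁ n₂ n₃ : LandauFree H × Fin 3),
    (∀ s : Fin 4, ∀ k : Fin 4, |((((![n₀, n₁, n₂, n₃] s).1.1.1.1 k - x k : ℤ)) : ℝ)| ≤ 1) →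
    |gaussAvg β H (fun a => (∑ b, ∑ b', LA b b' * (a b.1 b.2 * a b'.1 b'.2 - S b b')) *
          (∑ b, ∑ b', LB b b' * (a b.1 b.2 * a b'.1 b'.2 - S b b')) * (a n₀.1 n₀.2 * a n₁.1 n₁.2 * a n₂.1 n₂.2 * a n₃.1 n₃.2)) -
        gaussAvg β H (fun a => (∑ b, ∑ b', LA b b' * (a b.1 b.2 * a b'.1 b'.2 - S b b')) *
          (∑ b, ∑ b', LB b b' * (a b.1 b.2 * a b'.1 b'.2 - S b b'))) *
        gaussAvg β H (fun a => a n₀.1 n₀.2 * a n₁.1 n₁.2 * a n₂.1 n₂.2 * a n₃.1 n₃.2)| ≤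
      β⁻¹ ^ 4 * (C * (1 + Real.log H) ^ 4 * (1 / ((1 + siteDist x p.1) ^ 6 * (1 + siteDist x q.1) ^ 6) +
        1 / ((1 + (((∑ m : Fin 4, |p.1 m - q.1 m|) : ℤ) : ℝ)) ^ 4 * (1 + siteDist x p.1) ^ 3 * (1 + siteDist x q.1) ^ 3))) := by
  obtain ⟨CD₀, hDk⟩ := RestBlock.landauKernelGradDecay
  obtain ⟨CK₀, hKk⟩ := RestBlock.landauDipoleDecay
  obtain ⟨CS₀, hSk⟩ := EdgeChartGaussian.coldBox_propagator_decay
  set CD : ℝ := max CD₀ 0 with hCDdef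
  set CK : ℝ := max CK₀ 0 with hCKdef
  set CS : ℝ := max CS₀ 0 with hCSdef
  have hCD : 0 ≤ CD := le_max_right _ _
  have hCK : 0 ≤ CK := le_max_right _ _
  have hCS : 0 ≤ CS := le_max_right _ _
  refine ⟨24 * (64 * CD ^ 2) ^ 2 / 16 + 48 * (CK * (64 * CD ^ 2)) * CS / 16, by positivity, ?_⟩
  intro H hH β hβ p q S LA LB hS hLA hLB x n₀ n₁ n₂ n₃ hlegs
  have hH' : (1 : ℝ) ≤ H := by exact_mod_cast hH
  set Lg : ℝ := 1 + Real.log H with hLg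
  have hLg1 : 1 ≤ Lg := by have := Real.log_nonneg hH'; linarith
  have hLg0 : 0 ≤ Lg := by linarith
  set g : Matrix (LandauFree H) (LandauFree H) ℝ := (hodgeQ H)⁻¹ with hg
  set w₀ : LandauFree H → ℝ := landauCoeff H p with hw₀
  set w₁ : LandauFree H → ℝ := landauCoeff H q with hw₁
  set DA : LandauFree H × Fin 3 → LandauFree H × Fin 3 → ℝ := fun i j =>
    (2 * β)⁻¹ ^ 2 * if i.2 = j.2 then (w₀ ᵥ* g) i.1 * (w₀ ᵥ* g) j.1 else 0 with hDAdef
  set DB : LandauFree H × Fin 3 → LandauFree H × Fin 3 → ℝ := fun i j =>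
    (2 * β)⁻¹ ^ 2 * if i.2 = j.2 then (w₁ ᵥ* g) i.1 * (w₁ ᵥ* g) j.1 else 0 with hDBdef
  set TD : LandauFree H × Fin 3 → LandauFree H × Fin 3 → ℝ := fun i j =>
    (2 * β)⁻¹ ^ 3 * if i.2 = j.2 then ((w₀ ᵥ* g) ⬝ᵥ w₁) * ((w₀ ᵥ* g) i.1 * (w₁ ᵥ* g) j.1) else 0 with hTDdef
  rw [gaussAvg_centredRankOne_centredRankOne_mul_four_connected hβ w₀ w₁ S LA LB DA DB TD hS hLA hLB (fun i j => rfl) (fun i j => rfl)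
    (fun i j => rfl) n₀ n₁ n₂ n₃]
  -- gradient lines from a plaquette `r` to a leg near `x`
  have hgrad : ∀ (r : Plaq 4) (e : LandauFree H), (∀ k : Fin 4, |(((e.1.1.1 k - x k : ℤ)) : ℝ)| ≤ 1) →
      |(landauCoeff H r ᵥ* g) e| ≤ 8 * (CD * Lg) / (1 + siteDist x r.1) ^ 3 := by
    intro r e he
    rw [Cum3Triangle.vecMul_hodgeQ_inv]
    have h1 := hDk H hH e r
    have hx1 : siteDist e.1.1.1 x ≤ 1 := CubeTwoCentre.siteDist_le_of_forall _ _ he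
    have h2 : siteDist x r.1 ≤ siteDist e.1.1.1 x + siteDist e.1.1.1 r.1 := CubeTwoCentre.siteDist_triangle e.1.1.1 x r.1
    have hd0 := GhostKernel.siteDist_nonneg e.1.1.1 r.1
    have hdx := GhostKernel.siteDist_nonneg x r.1
    have h3 : 1 + siteDist x r.1 ≤ 2 * (1 + siteDist e.1.1.1 r.1) := by linarith
    calc |(g *ᵥ landauCoeff H r) e| ≤ CD₀ * Lg / (1 + (((∑ m : Fin 4, |e.1.1.1 m - r.1 m|) : ℤ) : ℝ)) ^ 3 := h1
      _ ≤ CD * Lg / (1 + (((∑ m : Fin 4, |e.1.1.1 m - r.1 m|) : ℤ) : ℝ)) ^ 3 :=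
          div_le_div_of_nonneg_right (mul_le_mul_of_nonneg_right (le_max_left _ _) hLg0) (by positivity)
      _ ≤ CD * Lg / (1 + siteDist e.1.1.1 r.1) ^ 3 := EdgeSums.div_l1_pow_le (by positivity) _ _ 3
      _ ≤ 8 * (CD * Lg) / (1 + siteDist x r.1) ^ 3 := by
          rw [div_le_div_iff₀ (by positivity) (by positivity)]
          calc CD * Lg * (1 + siteDist x r.1) ^ 3 ≤ CD * Lg * (2 * (1 + siteDist e.1.1.1 r.1)) ^ 3 := by gcongr
            _ = 8 * (CD * Lg) * (1 + siteDist e.1.1.1 r.1) ^ 3 := by ring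
  have hlegs' : ∀ s : Fin 4, ∀ k : Fin 4, |((((![n₀, n₁, n₂, n₃] s).1.1.1.1 k - x k : ℤ)) : ℝ)| ≤ 1 := hlegs
  have hl0 : ∀ k : Fin 4, |(((n₀.1.1.1.1 k - x k : ℤ)) : ℝ)| ≤ 1 := hlegs' 0
  have hl1 : ∀ k : Fin 4, |(((n₁.1.1.1.1 k - x k : ℤ)) : ℝ)| ≤ 1 := hlegs' 1
  have hl2 : ∀ k : Fin 4, |(((n₂.1.1.1.1 k - x k : ℤ)) : ℝ)| ≤ 1 := hlegs' 2
  have hl3 : ∀ k : Fin 4, |(((n₃.1.1.1.1 k - x k : ℤ)) : ℝ)| ≤ 1 := hlegs' 3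
  -- the three per-line sizes
  set GA : ℝ := 8 * (CD * Lg) / (1 + siteDist x p.1) ^ 3 with hGA
  set GB : ℝ := 8 * (CD * Lg) / (1 + siteDist x q.1) ^ 3 with hGB
  have hGA0 : 0 ≤ GA := by have := GhostKernel.siteDist_nonneg x p.1; positivity
  have hGB0 : 0 ≤ GB := by have := GhostKernel.siteDist_nonneg x q.1; positivity
  have hDAb : ∀ i j : LandauFree H × Fin 3, (∀ k : Fin 4, |(((i.1.1.1.1 k - x k : ℤ)) : ℝ)| ≤ 1) →
      (∀ k : Fin 4, |(((j.1.1.1.1 k - x k : ℤ)) : ℝ)| ≤ 1) → |DA i j| ≤ (2 * β)⁻¹ ^ 2 * (GA * GA) :=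
    fun i j hi hj => abs_smul_ite_mul_le (by positivity) _ (hgrad p i.1 hi) (hgrad p j.1 hj)
  have hDBb : ∀ i j : LandauFree H × Fin 3, (∀ k : Fin 4, |(((i.1.1.1.1 k - x k : ℤ)) : ℝ)| ≤ 1) →
      (∀ k : Fin 4, |(((j.1.1.1.1 k - x k : ℤ)) : ℝ)| ≤ 1) → |DB i j| ≤ (2 * β)⁻¹ ^ 2 * (GB * GB) :=
    fun i j hi hj => abs_smul_ite_mul_le (by positivity) _ (hgrad q i.1 hi) (hgrad q j.1 hj)
  have hK : |(w₀ ᵥ* g) ⬝ᵥ w₁| ≤ CK * Lg / (1 + (((∑ m : Fin 4, |p.1 m - q.1 m|) : ℤ) : ℝ)) ^ 4 := by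
    rw [← Matrix.dotProduct_mulVec]
    exact (hKk H hH p q).trans (div_le_div_of_nonneg_right (mul_le_mul_of_nonneg_right (le_max_left _ _) hLg0) (by positivity))
  set KK : ℝ := CK * Lg / (1 + (((∑ m : Fin 4, |p.1 m - q.1 m|) : ℤ) : ℝ)) ^ 4 with hKK
  have hKK0 : 0 ≤ KK := by positivity
  have hTDb : ∀ i j : LandauFree H × Fin 3, (∀ k : Fin 4, |(((i.1.1.1.1 k - x k : ℤ)) : ℝ)| ≤ 1) →
      (∀ k : Fin 4, |(((j.1.1.1.1 k - x k : ℤ)) : ℝ)| ≤ 1) → |TD i j| ≤ (2 * β)⁻¹ ^ 3 * (KK * (GA * GB)) :=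
    fun i j hi hj => abs_smul_ite_mul_mul_le (by positivity) _ hK (hgrad p i.1 hi) (hgrad q j.1 hj)
  have hSb : ∀ i j : LandauFree H × Fin 3, |S i j| ≤ (2 * β)⁻¹ * (CS * Lg) := by
    intro i j
    rw [hS]
    have h1 := hSk H hH β hβ i j
    refine h1.trans (mul_le_mul_of_nonneg_left ?_ (by positivity))
    have hd := GhostKernel.siteDist_nonneg i.1.1.1.1 j.1.1.1.1
    calc CS₀ * Lg / (1 + (⨆ k : Fin 4, |((i.1.1.1.1 k - j.1.1.1.1 k : ℤ) : ℝ)|)) ^ 2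
        ≤ CS * Lg / (1 + (⨆ k : Fin 4, |((i.1.1.1.1 k - j.1.1.1.1 k : ℤ) : ℝ)|)) ^ 2 :=
          div_le_div_of_nonneg_right (mul_le_mul_of_nonneg_right (le_max_left _ _) hLg0) (by positivity)
      _ ≤ CS * Lg := div_le_self (by positivity) (one_le_pow₀ (by change 1 ≤ 1 + siteDist i.1.1.1.1 j.1.1.1.1; linarith))
  -- assemble: 24 «X» terms and 48 tadpoles
  have hXt : ∀ (i j k l : LandauFree H × Fin 3), (∀ m : Fin 4, |(((i.1.1.1.1 m - x m : ℤ)) : ℝ)| ≤ 1) →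
      (∀ m : Fin 4, |(((j.1.1.1.1 m - x m : ℤ)) : ℝ)| ≤ 1) → (∀ m : Fin 4, |(((k.1.1.1.1 m - x m : ℤ)) : ℝ)| ≤ 1) →
      (∀ m : Fin 4, |(((l.1.1.1.1 m - x m : ℤ)) : ℝ)| ≤ 1) → |DA i j * DB k l| ≤ (2 * β)⁻¹ ^ 4 * (GA * GA * (GB * GB)) := by
    intro i j k l hi hj hk hl
    rw [abs_mul]
    calc |DA i j| * |DB k l| ≤ (2 * β)⁻¹ ^ 2 * (GA * GA) * ((2 * β)⁻¹ ^ 2 * (GB * GB)) :=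
          mul_le_mul (hDAb i j hi hj) (hDBb k l hk hl) (abs_nonneg _)
            (mul_nonneg (by positivity) (mul_nonneg hGA0 hGA0))
      _ = (2 * β)⁻¹ ^ 4 * (GA * GA * (GB * GB)) := by ring
  have hTt : ∀ (i j k l : LandauFree H × Fin 3), (∀ m : Fin 4, |(((i.1.1.1.1 m - x m : ℤ)) : ℝ)| ≤ 1) →
      (∀ m : Fin 4, |(((j.1.1.1.1 m - x m : ℤ)) : ℝ)| ≤ 1) → |TD i j * S k l| ≤ (2 * β)⁻¹ ^ 4 * (KK * (GA * GB) * (CS * Lg)) := by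
    intro i j k l hi hj
    rw [abs_mul]
    calc |TD i j| * |S k l| ≤ (2 * β)⁻¹ ^ 3 * (KK * (GA * GB)) * ((2 * β)⁻¹ * (CS * Lg)) :=
          mul_le_mul (hTDb i j hi hj) (hSb k l) (abs_nonneg _)
            (mul_nonneg (by positivity) (mul_nonneg hKK0 (mul_nonneg hGA0 hGB0)))
      _ = (2 * β)⁻¹ ^ 4 * (KK * (GA * GB) * (CS * Lg)) := by ring
  have x01 := hXt n₀ n₁ n₂ n₃ hl0 hl1 hl2 hl3
  have x02 := hXt n₀ n₂ n₁ n₃ hl0 hl2 hl1 hl3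
  have x03 := hXt n₀ n₃ n₁ n₂ hl0 hl3 hl1 hl2
  have x12 := hXt n₁ n₂ n₀ n₃ hl1 hl2 hl0 hl3
  have x13 := hXt n₁ n₃ n₀ n₂ hl1 hl3 hl0 hl2
  have x23 := hXt n₂ n₃ n₀ n₁ hl2 hl3 hl0 hl1
  have t01 := hTt n₀ n₁ n₂ n₃ hl0 hl1
  have t02 := hTt n₀ n₂ n₁ n₃ hl0 hl2
  have t03 := hTt n₀ n₃ n₁ n₂ hl0 hl3
  have t10 := hTt n₁ n₀ n₂ n₃ hl1 hl0
  have t12 := hTt n₁ n₂ n₀ n₃ hl1 hl2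
  have t13 := hTt n₁ n₃ n₀ n₂ hl1 hl3
  have t20 := hTt n₂ n₀ n₁ n₃ hl2 hl0
  have t21 := hTt n₂ n₁ n₀ n₃ hl2 hl1
  have t23 := hTt n₂ n₃ n₀ n₁ hl2 hl3
  have t30 := hTt n₃ n₀ n₁ n₂ hl3 hl0
  have t31 := hTt n₃ n₁ n₀ n₂ hl3 hl1
  have t32 := hTt n₃ n₂ n₀ n₁ hl3 hl2
  have hXsum : |DA n₀ n₁ * DB n₂ n₃ + DA n₀ n₂ * DB n₁ n₃ + DA n₀ n₃ * DB n₁ n₂ + DA n₁ n₂ * DB n₀ n₃ + DA n₁ n₃ * DB n₀ n₂ +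
      DA n₂ n₃ * DB n₀ n₁| ≤ 6 * ((2 * β)⁻¹ ^ 4 * (GA * GA * (GB * GB))) := by
    refine (abs_add_le _ _).trans ?_
    refine (add_le_add ((abs_add_le _ _).trans (add_le_add ((abs_add_le _ _).trans (add_le_add ((abs_add_le _ _).trans
      (add_le_add ((abs_add_le _ _).trans (add_le_add x01 x02)) x03)) x12)) x13)) x23).trans ?_
    linarith
  have hTsum : |TD n₀ n₁ * S n₂ n₃ + TD n₀ n₂ * S n₁ n₃ + TD n₀ n₃ * S n₁ n₂ + TD n₁ n₀ * S n₂ n₃ + TD n₁ n₂ * S n₀ n₃ +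
      TD n₁ n₃ * S n₀ n₂ + TD n₂ n₀ * S n₁ n₃ + TD n₂ n₁ * S n₀ n₃ + TD n₂ n₃ * S n₀ n₁ + TD n₃ n₀ * S n₁ n₂ + TD n₃ n₁ * S n₀ n₂ +
      TD n₃ n₂ * S n₀ n₁| ≤ 12 * ((2 * β)⁻¹ ^ 4 * (KK * (GA * GB) * (CS * Lg))) := by
    refine (abs_add_le _ _).trans ?_
    refine (add_le_add ((abs_add_le _ _).trans (add_le_add ((abs_add_le _ _).trans (add_le_add ((abs_add_le _ _).trans
      (add_le_add ((abs_add_le _ _).trans (add_le_add ((abs_add_le _ _).trans (add_le_add ((abs_add_le _ _).trans (add_le_add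
      ((abs_add_le _ _).trans (add_le_add ((abs_add_le _ _).trans (add_le_add ((abs_add_le _ _).trans (add_le_add
      ((abs_add_le _ _).trans (add_le_add t01 t02)) t03)) t10)) t12)) t13)) t20)) t21)) t23)) t30)) t31)) t32).trans ?_
    linarith
  have hβ0 : β ≠ 0 := hβ.ne'
  set G₁ : ℝ := 1 / ((1 + siteDist x p.1) ^ 6 * (1 + siteDist x q.1) ^ 6) with hG₁
  set G₂ : ℝ := 1 / ((1 + (((∑ m : Fin 4, |p.1 m - q.1 m|) : ℤ) : ℝ)) ^ 4 * (1 + siteDist x p.1) ^ 3 * (1 + siteDist x q.1) ^ 3) with hG₂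
  have hdp := GhostKernel.siteDist_nonneg x p.1
  have hdq := GhostKernel.siteDist_nonneg x q.1
  have hG₁0 : 0 ≤ G₁ := by positivity
  have hG₂0 : 0 ≤ G₂ := by positivity
  have h1 : (1 + siteDist x p.1) ^ 3 ≠ 0 := by positivity
  have h2 : (1 + siteDist x q.1) ^ 3 ≠ 0 := by positivity
  have h3 : (1 + (((∑ m : Fin 4, |p.1 m - q.1 m|) : ℤ) : ℝ)) ^ 4 ≠ 0 := by positivity
  have eX : 4 * (6 * ((2 * β)⁻¹ ^ 4 * (GA * GA * (GB * GB)))) = β⁻¹ ^ 4 * ((24 * (64 * CD ^ 2) ^ 2 / 16) * (Lg ^ 4 * G₁)) := by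
    rw [hGA, hGB, hG₁]
    field_simp
    ring
  have eT : 4 * (12 * ((2 * β)⁻¹ ^ 4 * (KK * (GA * GB) * (CS * Lg)))) = β⁻¹ ^ 4 * ((48 * (CK * (64 * CD ^ 2)) * CS / 16) * (Lg ^ 4 * G₂)) := by
    rw [hGA, hGB, hKK, hG₂]
    field_simp
    ring
  have hc1 : 0 ≤ 24 * (64 * CD ^ 2) ^ 2 / 16 := by positivity
  have hc2 : 0 ≤ 48 * (CK * (64 * CD ^ 2)) * CS / 16 := by positivity
  have hL4 : 0 ≤ Lg ^ 4 := by positivity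
  have hβ4 : 0 ≤ β⁻¹ ^ 4 := by positivity
  have hslack : 0 ≤ β⁻¹ ^ 4 * ((24 * (64 * CD ^ 2) ^ 2 / 16) * (Lg ^ 4 * G₂) + (48 * (CK * (64 * CD ^ 2)) * CS / 16) * (Lg ^ 4 * G₁)) :=
    mul_nonneg hβ4 (add_nonneg (mul_nonneg hc1 (mul_nonneg hL4 hG₂0)) (mul_nonneg hc2 (mul_nonneg hL4 hG₁0)))
  calc _ ≤ |4 * (DA n₀ n₁ * DB n₂ n₃ + DA n₀ n₂ * DB n₁ n₃ + DA n₀ n₃ * DB n₁ n₂ + DA n₁ n₂ * DB n₀ n₃ + DA n₁ n₃ * DB n₀ n₂ +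
          DA n₂ n₃ * DB n₀ n₁)| +
        |4 * (TD n₀ n₁ * S n₂ n₃ + TD n₀ n₂ * S n₁ n₃ + TD n₀ n₃ * S n₁ n₂ + TD n₁ n₀ * S n₂ n₃ + TD n₁ n₂ * S n₀ n₃ +
          TD n₁ n₃ * S n₀ n₂ + TD n₂ n₀ * S n₁ n₃ + TD n₂ n₁ * S n₀ n₃ + TD n₂ n₃ * S n₀ n₁ + TD n₃ n₀ * S n₁ n₂ + TD n₃ n₁ * S n₀ n₂ +
          TD n₃ n₂ * S n₀ n₁)| := abs_add_le _ _
    _ ≤ 4 * (6 * ((2 * β)⁻¹ ^ 4 * (GA * GA * (GB * GB)))) + 4 * (12 * ((2 * β)⁻¹ ^ 4 * (KK * (GA * GB) * (CS * Lg)))) := by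
        rw [abs_mul, abs_mul, abs_of_pos (by norm_num : (0 : ℝ) < 4)]
        exact add_le_add (mul_le_mul_of_nonneg_left hXsum (by norm_num)) (mul_le_mul_of_nonneg_left hTsum (by norm_num))
    _ = β⁻¹ ^ 4 * ((24 * (64 * CD ^ 2) ^ 2 / 16) * (Lg ^ 4 * G₁)) + β⁻¹ ^ 4 * ((48 * (CK * (64 * CD ^ 2)) * CS / 16) * (Lg ^ 4 * G₂)) := by
        rw [eX, eT]
    _ ≤ β⁻¹ ^ 4 * ((24 * (64 * CD ^ 2) ^ 2 / 16 + 48 * (CK * (64 * CD ^ 2)) * CS / 16) * Lg ^ 4 * (G₁ + G₂)) := by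
        have e : β⁻¹ ^ 4 * ((24 * (64 * CD ^ 2) ^ 2 / 16 + 48 * (CK * (64 * CD ^ 2)) * CS / 16) * Lg ^ 4 * (G₁ + G₂)) =
            β⁻¹ ^ 4 * ((24 * (64 * CD ^ 2) ^ 2 / 16) * (Lg ^ 4 * G₁)) + β⁻¹ ^ 4 * ((48 * (CK * (64 * CD ^ 2)) * CS / 16) * (Lg ^ 4 * G₂)) +
            β⁻¹ ^ 4 * ((24 * (64 * CD ^ 2) ^ 2 / 16) * (Lg ^ 4 * G₂) + (48 * (CK * (64 * CD ^ 2)) * CS / 16) * (Lg ^ 4 * G₁)) := by ring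
        rw [e]
        linarith
    _ = _ := by rw [hG₁, hG₂]

end WickPairCubic

end Summit.QuantumFields.YangMills.Theorems.AllWindowsColdBoxBoxHighLine

end
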